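import Literature.NumberTheory.LFunctions.WeilExplicit
import Literature.NumberTheory.LFunctions.ZetaZeros

/-!
# Stub `stub_windowSum` for crux `SignCone.OscCoherentCore` (line Sketch, item stmt-RiemannHypothesis-18013)

WINDOW BOOKKEEPING. If every height window `|Im ρ - t| ≤ 1/a` (`a ≥ 1`) carries weighted off-line
second moment `Σ m(ρ) (Re ρ - 1/2)² ≤ κ` (zeros of `ζ` with `0 ≤ Re ρ ≤ 1`, `Im ρ ≠ 0`, each listed
once, `m = riemannZetaZeroOrder`), then for every `ξ` and `T` the Cauchy-weighted sum over the
truncated zero index `weilZeroIndex T` of the explicit formula is at most `κ (4a + 4)`.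

Proof: the index set is finite (`weilZeroIndex_finite`), so the `finsum` is a `Finset` sum. Partition
it by the window index `j(ρ) = ⌊(a (Im ρ - ξ) + 1)/2⌋ ∈ ℤ` (`Finset.sum_fiberwise_of_maps_to`). On the
`j`-th fibre `|Im ρ - (ξ + 2j/a)| ≤ 1/a`, so the window law applies with centre `ξ + 2j/a`, and the
Cauchy weight is at most `a²/(a² + j²)` (all summands are `≥ 0` since `m(ρ) ≥ 0` away from the pole,
`riemannZetaZeroOrder_nonneg`). Finally `Σ_{j ∈ J} a²/(a² + j²) ≤ 4a + 4` for every finite `J ⊆ ℤ`,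
by telescoping against the bounded monotone potential `b(j) = -(2a + 2) j/(|j| + a)`.
Support lemma; it does not close the item.
-/

noncomputable section

-- `Summit.RiemannHypothesis.RiemannHypothesis.…` repeats a namespace component by design (D-0017 layout).
set_option linter.dupNamespace false

open scoped BigOperators Real
open Complex MeasureTheory Set Filter

namespace Summit.RiemannHypothesis.RiemannHypothesis.Theorems.OscCoherentCore

open Literature.NumberTheory.LFunctions

/-- Telescoping bound on `ℤ`: if `0 ≤ w j ≤ b j - b (j + 1)` and `|b j| ≤ M` for all `j`, then every
finite sum of `w` is at most `2M` (induct on the `Finset` through its maximum). [folklore] -/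
theorem windowSum_sum_le_of_telescope (w b : ℤ → ℝ) (M : ℝ) (hw0 : ∀ j, 0 ≤ w j)
    (hwb : ∀ j, w j ≤ b j - b (j + 1)) (hbM : ∀ j, |b j| ≤ M) (J : Finset ℤ) :
    ∑ j ∈ J, w j ≤ 2 * M := by
  have hanti : Antitone b := antitone_int_of_succ_le fun j => by linarith [hw0 j, hwb j]
  have key : ∀ k : ℤ, (∀ x ∈ J, x < k) → ∑ j ∈ J, w j ≤ M - b k := by
    induction J using Finset.induction_on_max with
    | empty =>
      intro k _
      rw [Finset.sum_empty]
      linarith [(abs_le.1 (hbM k)).2]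
    | insert i s hs ih =>
      intro k hk
      have hnot : i ∉ s := fun h => lt_irrefl i (hs i h)
      rw [Finset.sum_insert hnot]
      have h1 := ih i hs
      have hik : i + 1 ≤ k := Int.lt_iff_add_one_le.1 (hk i (Finset.mem_insert_self i s))
      have h2 := hanti hik
      linarith [hwb i]
  obtain ⟨m, hm⟩ := Finset.exists_le J
  have h := key (m + 1) fun x hx => Int.lt_add_one_iff.2 (hm x hx)
  linarith [(abs_le.1 (hbM (m + 1))).1]

/-- The Cauchy weights of the windows sum to at most `4a + 4`: for `a ≥ 1` and every finite `J ⊆ ℤ`,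
`Σ_{j ∈ J} a²/(a² + j²) ≤ 4a + 4` (telescoping against `b(j) = -(2a + 2) j/(|j| + a)`, whose steps
`b(j) - b(j+1) = (2a + 2) a/((|j| + a)(|j + 1| + a))` dominate `a²/(a² + j²)`). [folklore] -/
theorem windowSum_weight_sum_le (a : ℝ) (ha : 1 ≤ a) (J : Finset ℤ) :
    ∑ j ∈ J, a ^ 2 / (a ^ 2 + (j : ℝ) ^ 2) ≤ 4 * a + 4 := by
  have ha0 : 0 < a := by linarith
  have poly : ∀ t : ℝ,
      a ^ 2 * ((t + a) * (t + 1 + a)) ≤ (2 * a + 2) * a * (a ^ 2 + t ^ 2) := by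
    intro t
    nlinarith [mul_nonneg (mul_nonneg ha0.le ha0.le) (sq_nonneg (a - t)),
      mul_nonneg ha0.le (sq_nonneg (a - t / 2)), mul_nonneg ha0.le (sq_nonneg t)]
  have hw0 : ∀ j : ℤ, 0 ≤ a ^ 2 / (a ^ 2 + (j : ℝ) ^ 2) := fun j => by positivity
  have hbM : ∀ j : ℤ, |-(2 * a + 2) * (j : ℝ) / (|(j : ℝ)| + a)| ≤ 2 * a + 2 := by
    intro j
    have hpos : (0 : ℝ) < |(j : ℝ)| + a := by positivity
    rw [abs_div, abs_of_pos hpos, div_le_iff₀ hpos, abs_mul, abs_neg,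
      abs_of_pos (by linarith : (0 : ℝ) < 2 * a + 2)]
    nlinarith [mul_nonneg (by linarith : (0 : ℝ) ≤ 2 * a + 2) ha0.le, abs_nonneg (j : ℝ)]
  have hwb : ∀ j : ℤ, a ^ 2 / (a ^ 2 + (j : ℝ) ^ 2) ≤
      -(2 * a + 2) * (j : ℝ) / (|(j : ℝ)| + a) -
        -(2 * a + 2) * ((j + 1 : ℤ) : ℝ) / (|((j + 1 : ℤ) : ℝ)| + a) := by
    intro j
    have hcast : ((j + 1 : ℤ) : ℝ) = (j : ℝ) + 1 := by push_cast; ring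
    rw [hcast]
    rcases le_or_gt 0 j with hj | hj
    · have hj' : (0 : ℝ) ≤ (j : ℝ) := by exact_mod_cast hj
      have h1 : (0 : ℝ) < (j : ℝ) + a := by linarith
      have h2 : (0 : ℝ) < (j : ℝ) + 1 + a := by linarith
      have h1' := h1.ne'
      have h2' := h2.ne'
      rw [abs_of_nonneg hj', abs_of_nonneg (by linarith : (0 : ℝ) ≤ (j : ℝ) + 1)]
      have key : -(2 * a + 2) * (j : ℝ) / ((j : ℝ) + a) -
          -(2 * a + 2) * ((j : ℝ) + 1) / ((j : ℝ) + 1 + a) =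
            (2 * a + 2) * a / (((j : ℝ) + a) * ((j : ℝ) + 1 + a)) := by
        field_simp
        ring
      rw [key, div_le_div_iff₀ (by positivity) (mul_pos h1 h2)]
      exact poly j
    · have hj1 : j + 1 ≤ 0 := by omega
      have hj1' : (j : ℝ) + 1 ≤ 0 := by exact_mod_cast hj1
      have hj' : (j : ℝ) ≤ 0 := by linarith
      have h1 : (0 : ℝ) < -(j : ℝ) + a := by linarith
      have h2 : (0 : ℝ) < -((j : ℝ) + 1) + a := by linarith
      have h3 : (0 : ℝ) < -((j : ℝ) + 1) + 1 + a := by linarith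
      have h1' := h1.ne'
      have h2' := h2.ne'
      have h3' := h3.ne'
      rw [abs_of_nonpos hj', abs_of_nonpos hj1']
      have key : -(2 * a + 2) * (j : ℝ) / (-(j : ℝ) + a) -
          -(2 * a + 2) * ((j : ℝ) + 1) / (-((j : ℝ) + 1) + a) =
            (2 * a + 2) * a / ((-((j : ℝ) + 1) + a) * (-((j : ℝ) + 1) + 1 + a)) := by
        field_simp
        ring
      rw [key, div_le_div_iff₀ (by positivity) (mul_pos h2 h3)]
      nlinarith [poly (-((j : ℝ) + 1)),
        mul_nonneg (mul_nonneg (by linarith : (0 : ℝ) ≤ 2 * a + 2) ha0.le)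
          (by linarith : (0 : ℝ) ≤ -(2 * (j : ℝ) + 1))]
  have h : ∑ j ∈ J, a ^ 2 / (a ^ 2 + (j : ℝ) ^ 2) ≤ 2 * (2 * a + 2) :=
    windowSum_sum_le_of_telescope (fun j : ℤ => a ^ 2 / (a ^ 2 + (j : ℝ) ^ 2))
      (fun j : ℤ => -(2 * a + 2) * (j : ℝ) / (|(j : ℝ)| + a)) (2 * a + 2) hw0 hwb hbM J
  linarith

/-- Window index: with `j = ⌊(a (x - ξ) + 1)/2⌋` one has `|a (x - ξ) - 2 j| ≤ 1`. [folklore] -/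
theorem windowSum_abs_sub_le (a x ξ : ℝ) :
    |a * (x - ξ) - 2 * (⌊(a * (x - ξ) + 1) / 2⌋ : ℝ)| ≤ 1 := by
  have h1 := Int.floor_le ((a * (x - ξ) + 1) / 2)
  have h2 := Int.lt_floor_add_one ((a * (x - ξ) + 1) / 2)
  rw [abs_le]
  constructor <;> linarith

/-- On the `j`-th window (`⌊(a (x - ξ) + 1)/2⌋ = j`) the point `x` is within `1/a` of the centre
`ξ + 2j/a`. [folklore] -/
theorem windowSum_mem_window {a : ℝ} (ha : 0 < a) (x ξ : ℝ) (j : ℤ)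
    (hj : ⌊(a * (x - ξ) + 1) / 2⌋ = j) : |x - (ξ + 2 * j / a)| ≤ 1 / a := by
  have h := windowSum_abs_sub_le a x ξ
  rw [hj] at h
  have ha' := ha.ne'
  rw [show x - (ξ + 2 * j / a) = (a * (x - ξ) - 2 * j) / a by field_simp; ring, abs_div,
    abs_of_pos ha]
  exact (div_le_div_iff_of_pos_right ha).2 h

/-- On the `j`-th window (`⌊(a (x - ξ) + 1)/2⌋ = j`) the Cauchy weight is at most `a²/(a² + j²)`:
`|a (x - ξ)| ≥ 2|j| - 1 ≥ |j|` for `j ≠ 0`. [folklore] -/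
theorem windowSum_weight_le {a : ℝ} (ha : 0 < a) (x ξ : ℝ) (j : ℤ)
    (hj : ⌊(a * (x - ξ) + 1) / 2⌋ = j) :
    1 / (1 + (x - ξ) ^ 2) ≤ a ^ 2 / (a ^ 2 + (j : ℝ) ^ 2) := by
  have h := windowSum_abs_sub_le a x ξ
  rw [hj] at h
  have hsq : (j : ℝ) ^ 2 ≤ (a * (x - ξ)) ^ 2 := by
    rcases eq_or_ne j 0 with h0 | h0
    · rw [h0, Int.cast_zero]
      nlinarith [sq_nonneg (a * (x - ξ))]
    · have h1 : (1 : ℝ) ≤ |(j : ℝ)| := by exact_mod_cast Int.one_le_abs h0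
      have h2 : |2 * (j : ℝ)| - |a * (x - ξ)| ≤ 1 := by
        have := abs_sub_abs_le_abs_sub (2 * (j : ℝ)) (a * (x - ξ))
        rw [abs_sub_comm] at this
        linarith
      have h3 : |(j : ℝ)| ≤ |a * (x - ξ)| := by
        rw [abs_mul, abs_two] at h2
        linarith
      exact sq_le_sq.2 h3
  rw [div_le_div_iff₀ (by positivity) (by positivity)]
  nlinarith [hsq]

/-- STUB D (window bookkeeping). If every height window `|Im ρ - t| ≤ 1/a` carries weighted off-line second
moment `Σ m(ρ)(Re ρ - 1/2)² ≤ κ` (zeros of `ζ` with `0 ≤ Re ρ ≤ 1`, `Im ρ ≠ 0`, each listed once), then for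
every `ξ` and `T` the Cauchy-weighted sum over the truncated zero index is at most `κ (4a + 4)`: cover
`weilZeroIndex T` (finite) by the windows centred at `ξ + 2j/a`, `j ∈ ℤ`, on which
`1/(1 + (Im ρ - ξ)²) ≤ a²/(a² + j²)`, and `Σ_j a²/(a² + j²) ≤ 4a + 4`. [folklore] -/
theorem stub_windowSum :
    ∀ a κ : ℝ, 1 ≤ a → 0 ≤ κ →
      (∀ (t : ℝ) (S : Finset ℂ),
        (∀ ρ ∈ S, riemannZeta ρ = 0 ∧ 0 ≤ ρ.re ∧ ρ.re ≤ 1 ∧ ρ.im ≠ 0 ∧ |ρ.im - t| ≤ 1 / a) →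
        ∑ ρ ∈ S, (riemannZetaZeroOrder ρ : ℝ) * (ρ.re - 1 / 2) ^ 2 ≤ κ) →
      ∀ ξ T : ℝ, ∑ᶠ ρ ∈ weilZeroIndex T,
        (riemannZetaZeroOrder ρ : ℝ) * (ρ.re - 1 / 2) ^ 2 / (1 + (ρ.im - ξ) ^ 2) ≤ κ * (4 * a + 4) := by
  intro a κ ha hκ H ξ T
  have ha0 : 0 < a := by linarith
  rw [finsum_mem_eq_finite_toFinset_sum _ (weilZeroIndex_finite T)]
  set F : Finset ℂ := (weilZeroIndex_finite T).toFinset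
  have hmemF : ∀ ρ ∈ F, riemannZeta ρ = 0 ∧ 0 ≤ ρ.re ∧ ρ.re ≤ 1 ∧ ρ.im ≠ 0 ∧ |ρ.im| ≤ T :=
    fun ρ hρ => (Set.Finite.mem_toFinset (weilZeroIndex_finite T)).1 hρ
  -- the window index
  let idx : ℂ → ℤ := fun ρ => ⌊(a * (ρ.im - ξ) + 1) / 2⌋
  rw [← Finset.sum_fiberwise_of_maps_to (fun ρ hρ => Finset.mem_image_of_mem idx hρ)
    (fun ρ => (riemannZetaZeroOrder ρ : ℝ) * (ρ.re - 1 / 2) ^ 2 / (1 + (ρ.im - ξ) ^ 2))]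
  -- per-window bound
  have hfibre : ∀ j : ℤ, ∑ ρ ∈ F.filter (fun ρ => idx ρ = j),
      (riemannZetaZeroOrder ρ : ℝ) * (ρ.re - 1 / 2) ^ 2 / (1 + (ρ.im - ξ) ^ 2) ≤
        κ * (a ^ 2 / (a ^ 2 + (j : ℝ) ^ 2)) := by
    intro j
    have hS : ∀ ρ ∈ F.filter (fun ρ => idx ρ = j), ρ ∈ F ∧ ⌊(a * (ρ.im - ξ) + 1) / 2⌋ = j :=
      fun ρ hρ => Finset.mem_filter.1 hρ
    have hsum : ∑ ρ ∈ F.filter (fun ρ => idx ρ = j),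
        (riemannZetaZeroOrder ρ : ℝ) * (ρ.re - 1 / 2) ^ 2 ≤ κ := by
      refine H (ξ + 2 * j / a) _ fun ρ hρ => ?_
      obtain ⟨hρF, hρj⟩ := hS ρ hρ
      obtain ⟨h0, h1, h2, h3, -⟩ := hmemF ρ hρF
      exact ⟨h0, h1, h2, h3, windowSum_mem_window ha0 ρ.im ξ j hρj⟩
    have hle : ∀ ρ ∈ F.filter (fun ρ => idx ρ = j),
        (riemannZetaZeroOrder ρ : ℝ) * (ρ.re - 1 / 2) ^ 2 / (1 + (ρ.im - ξ) ^ 2) ≤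
          a ^ 2 / (a ^ 2 + (j : ℝ) ^ 2) * ((riemannZetaZeroOrder ρ : ℝ) * (ρ.re - 1 / 2) ^ 2) := by
      intro ρ hρ
      obtain ⟨hρF, hρj⟩ := hS ρ hρ
      obtain ⟨-, -, -, h3, -⟩ := hmemF ρ hρF
      have hne : ρ ≠ 1 := fun h => h3 (by rw [h, Complex.one_im])
      have hm : (0 : ℝ) ≤ (riemannZetaZeroOrder ρ : ℝ) := by
        exact_mod_cast riemannZetaZeroOrder_nonneg hne
      have hbase : 0 ≤ (riemannZetaZeroOrder ρ : ℝ) * (ρ.re - 1 / 2) ^ 2 :=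
        mul_nonneg hm (sq_nonneg _)
      calc (riemannZetaZeroOrder ρ : ℝ) * (ρ.re - 1 / 2) ^ 2 / (1 + (ρ.im - ξ) ^ 2)
          = 1 / (1 + (ρ.im - ξ) ^ 2) * ((riemannZetaZeroOrder ρ : ℝ) * (ρ.re - 1 / 2) ^ 2) := by
            ring
        _ ≤ a ^ 2 / (a ^ 2 + (j : ℝ) ^ 2) * ((riemannZetaZeroOrder ρ : ℝ) * (ρ.re - 1 / 2) ^ 2) :=
            mul_le_mul_of_nonneg_right (windowSum_weight_le ha0 ρ.im ξ j hρj) hbase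
    calc ∑ ρ ∈ F.filter (fun ρ => idx ρ = j),
          (riemannZetaZeroOrder ρ : ℝ) * (ρ.re - 1 / 2) ^ 2 / (1 + (ρ.im - ξ) ^ 2)
        ≤ ∑ ρ ∈ F.filter (fun ρ => idx ρ = j),
            a ^ 2 / (a ^ 2 + (j : ℝ) ^ 2) * ((riemannZetaZeroOrder ρ : ℝ) * (ρ.re - 1 / 2) ^ 2) :=
          Finset.sum_le_sum hle
      _ = a ^ 2 / (a ^ 2 + (j : ℝ) ^ 2) * ∑ ρ ∈ F.filter (fun ρ => idx ρ = j),
            (riemannZetaZeroOrder ρ : ℝ) * (ρ.re - 1 / 2) ^ 2 := by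
          rw [Finset.mul_sum]
      _ ≤ a ^ 2 / (a ^ 2 + (j : ℝ) ^ 2) * κ := mul_le_mul_of_nonneg_left hsum (by positivity)
      _ = κ * (a ^ 2 / (a ^ 2 + (j : ℝ) ^ 2)) := mul_comm _ _
  calc ∑ j ∈ F.image idx, ∑ ρ ∈ F.filter (fun ρ => idx ρ = j),
        (riemannZetaZeroOrder ρ : ℝ) * (ρ.re - 1 / 2) ^ 2 / (1 + (ρ.im - ξ) ^ 2)
      ≤ ∑ j ∈ F.image idx, κ * (a ^ 2 / (a ^ 2 + (j : ℝ) ^ 2)) :=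
        Finset.sum_le_sum fun j _ => hfibre j
    _ = κ * ∑ j ∈ F.image idx, a ^ 2 / (a ^ 2 + (j : ℝ) ^ 2) := by rw [Finset.mul_sum]
    _ ≤ κ * (4 * a + 4) := mul_le_mul_of_nonneg_left (windowSum_weight_sum_le a ha _) hκ

end Summit.RiemannHypothesis.RiemannHypothesis.Theorems.OscCoherentCore

end
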